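import Mathlib
import Summits.RiemannHypothesis.RiemannHypothesis.Theorems.IntegerScrewExitAtomGreen
import Summits.RiemannHypothesis.RiemannHypothesis.Theorems.IntegerScrewExitGreenLower
import Summits.RiemannHypothesis.RiemannHypothesis.Theorems.IntegerScrewRangeAbel
import HarnessLib

/-!
# Route `IntegerScrew` — THEOREM B's tilt `τ(b)`: exact prime-sum form and two-sided bounds
# (CONTINUUM-LIMIT §25.10 (a)–(b) in the kernel)

THEOREM B's cell: `p ≥ 3`, `R < p²` (`u < 2`), window `(Q, R]` with `Q = R/p`, atom `𝒜 = p`-free numbers.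
By `exitInflow_sub_exitInflowAtom` the atom's exit density on `b ≤ Q` is `b·ν^𝒜(b) = b·ν(b) − τ(b)` with
`τ(b) = Σ_{n ≤ R/b, n not p-free} Γ(bn)Λ(n)/(n log(bn))`; since `R < p²` the only non-`p`-free prime powers
`n ≤ R` are the PRIMES `q ∈ [p, R/b]` (25.10 (a)), so `τ(b) = Σ_{p ≤ q ≤ R/b} Γ(bq)·log q/(q·log(bq))`, and the
two-sided bounds `B·L/log y ≤ Γ(y) ≤ A·L/log y` (`exitGamma_le`, `le_exitGamma`) together with range Abel
summation over the primes (`IntegerScrewRangeAbel`, prime sums `Σ_{q≤x} log q/q = log x + O(1)` from both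
sides as HYPOTHESES with constants `E_lo`, `E_hi`) give 25.10 (b):

* `primeLogDiv n = 𝟙[n prime]·log n/n`; `exitTilt R p b = b·(exitInflow R (R/p) b − exitInflowAtom R (R/p) p b)`;
* `exitTilt_eq_sum`, **`exitTilt_eq_sum_primes`** (`R < p²`), `exitTilt_nonneg`, `exitTilt_eq_zero_of_lt`
  (`R/b < p ⇒ τ(b) = 0`);
* **`exitTilt_le`** — `τ(b) ≤ A·log R·[(E_lo+E_hi)/log²(b(p−1)) + 1/log(b(p−1)) − 1/(log b + log⌊R/b⌋)]`;
* **`le_exitTilt`** — `τ(b) ≥ B·log R·[1/log(bp) − 1/(log b + log(⌊R/b⌋+1)) − (E_lo+E_hi)/log²(b(p−1))]`;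
  i.e. `τ(b) = T(b) + O(L·(E_lo+E_hi)/λ²) + O((A−B)·T)`, `T(b) = L/(log b + λ) − 1` — the deterministic,
  decreasing tilt profile of THEOREM B (`T(1) = u − 1`, `T(Q) ≈ 0`).

RH-free, elementary.  Nothing in this file bears on the truth of RH.
References: CONTINUUM-LIMIT §25.10 (rh-explicit A6-PIVOT); M. Suzuki, J. Lond. Math. Soc. (2) 108 (2023)
1448–1487 [Suzuki2023].
-/

noncomputable section

set_option linter.dupNamespace false -- D-0017: `Summit.<S>.<S>.…` is the designed namespace

namespace Summit.RiemannHypothesis.RiemannHypothesis.Theorems.IntegerScrew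

open Finset Real
open ArithmeticFunction (vonMangoldt)

/-! ### Definitions -/

/-- The prime weight `𝟙[n prime]·log n/n` (Mertens' first theorem for primes sums it).
[cite: Suzuki2023, §1 (the screw matrices S_M whose pivot/spectral theory this serves)] -/
def primeLogDiv (n : ℕ) : ℝ := if n.Prime then Real.log n / n else 0

/-- `primeLogDiv ≥ 0`. -/
theorem primeLogDiv_nonneg (n : ℕ) : 0 ≤ primeLogDiv n := by
  unfold primeLogDiv
  split_ifs
  · exact div_nonneg (Real.log_natCast_nonneg n) (Nat.cast_nonneg n)
  · exact le_rfl

/-- **The tilt** `τ(b) = b·(ν(b) − ν^𝒜(b))` of the `p`-free atom with window `(R/p, R]`.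
[cite: Suzuki2023, §1 (the screw matrices S_M whose pivot/spectral theory this serves)] -/
def exitTilt (R p b : ℕ) : ℝ := (b : ℝ) * (exitInflow R (R / p) b - exitInflowAtom R (R / p) p b)

/-- `τ(b) = Σ_{n ≤ R/b, n not p-free} Γ(bn)·Λ(n)/(n·log(bn))`. -/
theorem exitTilt_eq_sum {R p b : ℕ} (hp : 1 ≤ p) (hb : 1 ≤ b) :
    exitTilt R p b = ∑ n ∈ (Icc 1 (R / b)).filter (· ∉ Nat.smoothNumbers p),
      exitGamma R (R / p) (b * n) * (vonMangoldt n / ((n : ℝ) * Real.log ((b * n : ℕ) : ℝ))) := by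
  unfold exitTilt
  rw [exitInflow_sub_exitInflowAtom hp le_rfl b, Finset.mul_sum]
  refine Finset.sum_congr rfl fun n hn => ?_
  have hn0 : (n : ℝ) ≠ 0 := by
    have := (Finset.mem_Icc.1 (Finset.mem_filter.1 hn).1).1
    exact_mod_cast (show n ≠ 0 by omega)
  have hb0 : (b : ℝ) ≠ 0 := by exact_mod_cast (show b ≠ 0 by omega)
  push_cast
  field_simp

/-- `τ(b) ≥ 0`. -/
theorem exitTilt_nonneg {R p b : ℕ} (hp : 1 ≤ p) (hb : 1 ≤ b) : 0 ≤ exitTilt R p b := by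
  rw [exitTilt_eq_sum hp hb]
  exact Finset.sum_nonneg fun n _ => mul_nonneg (exitGamma_nonneg R _ _)
    (div_nonneg ArithmeticFunction.vonMangoldt_nonneg (mul_nonneg (Nat.cast_nonneg _) (Real.log_natCast_nonneg _)))

/-- For `R < p²`, a non-`p`-free `n ≤ R` with `Λ(n) ≠ 0` is a prime `≥ p`. -/
theorem prime_of_not_smooth_of_vonMangoldt_ne_zero {R p n : ℕ} (hR : R < p ^ 2) (hnR : n ≤ R)
    (hns : n ∉ Nat.smoothNumbers p) (hΛ : vonMangoldt n ≠ 0) : n.Prime ∧ p ≤ n := by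
  rw [ArithmeticFunction.vonMangoldt_ne_zero_iff] at hΛ
  obtain ⟨q, k, hq, hk, rfl⟩ := (isPrimePow_nat_iff _).1 hΛ
  -- q ≥ p (otherwise q^k would be p-free)
  have hqp : p ≤ q := by
    by_contra hlt
    push Not at hlt
    apply hns
    rw [Nat.mem_smoothNumbers]
    refine ⟨(pow_pos hq.pos k).ne', fun r hr => ?_⟩
    have hr' := (Nat.mem_primeFactorsList (pow_pos hq.pos k).ne').1 hr
    have : r = q := (Nat.prime_dvd_prime_iff_eq hr'.1 hq).1 (hr'.1.dvd_of_dvd_pow hr'.2)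
    rw [this]; exact hlt
  -- k = 1 (otherwise q^k ≥ p² > R)
  have hk1 : k = 1 := by
    by_contra hk1
    have hk2 : 2 ≤ k := by omega
    have : p ^ 2 ≤ q ^ k := le_trans (Nat.pow_le_pow_left hqp 2) (Nat.pow_le_pow_right hq.pos hk2)
    omega
  subst hk1
  rw [pow_one]
  exact ⟨hq, hqp⟩

/-- **`τ(b)` is a prime sum** (`R < p²`, `p ≥ 2`, `b ≥ 1`):
`τ(b) = Σ_{q prime, p ≤ q ≤ R/b} Γ(bq)·log q/(q·log(bq))`. -/
theorem exitTilt_eq_sum_primes {R p b : ℕ} (hp : 2 ≤ p) (hR : R < p ^ 2) (hb : 1 ≤ b) :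
    exitTilt R p b = ∑ q ∈ (Icc p (R / b)).filter Nat.Prime,
      exitGamma R (R / p) (b * q) * (Real.log q / ((q : ℝ) * Real.log ((b * q : ℕ) : ℝ))) := by
  rw [exitTilt_eq_sum (by omega) hb]
  have hsub : (Icc p (R / b)).filter Nat.Prime ⊆ (Icc 1 (R / b)).filter (· ∉ Nat.smoothNumbers p) := by
    intro q hq
    have hq' := Finset.mem_filter.1 hq
    have hI := Finset.mem_Icc.1 hq'.1
    refine Finset.mem_filter.2 ⟨Finset.mem_Icc.2 ⟨hq'.2.one_lt.le, hI.2⟩, fun hs => ?_⟩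
    have := (Nat.mem_smoothNumbers.1 hs).2 q ((Nat.mem_primeFactorsList hq'.2.ne_zero).2 ⟨hq'.2, dvd_rfl⟩)
    omega
  rw [← Finset.sum_subset hsub]
  · refine Finset.sum_congr rfl fun q hq => ?_
    rw [ArithmeticFunction.vonMangoldt_apply_prime (Finset.mem_filter.1 hq).2]
  · intro n hn hn2
    have hn' := Finset.mem_filter.1 hn
    have hI := Finset.mem_Icc.1 hn'.1
    have hnR : n ≤ R := hI.2.trans (Nat.div_le_self R b)
    by_cases hΛ : vonMangoldt n = 0
    · rw [hΛ, zero_div, mul_zero]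
    · exfalso
      have h := prime_of_not_smooth_of_vonMangoldt_ne_zero hR hnR hn'.2 hΛ
      exact hn2 (Finset.mem_filter.2 ⟨Finset.mem_Icc.2 ⟨h.2, hI.2⟩, h.1⟩)

/-- If `R/b < p` the range of primes is empty: `τ(b) = 0`. -/
theorem exitTilt_eq_zero_of_lt {R p b : ℕ} (hp : 2 ≤ p) (hR : R < p ^ 2) (hb : 1 ≤ b) (hbR : R / b < p) :
    exitTilt R p b = 0 := by
  rw [exitTilt_eq_sum_primes hp hR hb]
  refine Finset.sum_eq_zero fun q hq => ?_
  have := Finset.mem_Icc.1 (Finset.mem_filter.1 hq).1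
  omega

/-! ### Rewriting the prime sum with `primeLogDiv` -/

/-- For a function `h`: `Σ_{q prime ∈ [p, N]} h(q)·log q/q = Σ_{n ∈ [p, N]} primeLogDiv(n)·h(n)`. -/
theorem sum_filter_prime_eq_sum_primeLogDiv (p N : ℕ) (h : ℕ → ℝ) :
    ∑ q ∈ (Icc p N).filter Nat.Prime, h q * (Real.log q / q) = ∑ n ∈ Icc p N, primeLogDiv n * h n := by
  rw [Finset.sum_filter]
  refine Finset.sum_congr rfl fun n _ => ?_
  unfold primeLogDiv
  split_ifs <;> ring

/-- Partial sums of `primeLogDiv` over `(m, n]` from two-sided Mertens bounds: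
`S(n) ≤ log n + E_hi`, `log n − E_lo ≤ S(n)` (`S(n) = Σ_{k≤n} primeLogDiv k`, `n ≥ 1`). -/
theorem sum_Icc_primeLogDiv_le {m n : ℕ} (hm : 1 ≤ m) (hmn : m + 1 ≤ n) {Elo Ehi : ℝ}
    (hhi : ∀ n : ℕ, 1 ≤ n → ∑ k ∈ Icc 1 n, primeLogDiv k ≤ Real.log n + Ehi)
    (hlo : ∀ n : ℕ, 1 ≤ n → Real.log n - Elo ≤ ∑ k ∈ Icc 1 n, primeLogDiv k) :
    ∑ k ∈ Icc (m + 1) n, primeLogDiv k ≤ Real.log n - Real.log m + (Elo + Ehi) := by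
  have hsplit : ∑ k ∈ Icc 1 n, primeLogDiv k = ∑ k ∈ Icc 1 m, primeLogDiv k + ∑ k ∈ Icc (m + 1) n, primeLogDiv k := by
    have hU : Icc 1 n = Icc 1 m ∪ Icc (m + 1) n := by
      ext k; simp only [Finset.mem_union, Finset.mem_Icc]; omega
    rw [hU, Finset.sum_union]
    rw [Finset.disjoint_left]; intro k hk hk'
    have := Finset.mem_Icc.1 hk; have := Finset.mem_Icc.1 hk'; omega
  have h1 := hhi n (by omega)
  have h2 := hlo m hm
  linarith

/-- Lower companion of `sum_Icc_primeLogDiv_le`. -/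
theorem le_sum_Icc_primeLogDiv {m n : ℕ} (hm : 1 ≤ m) (hmn : m + 1 ≤ n) {Elo Ehi : ℝ}
    (hhi : ∀ n : ℕ, 1 ≤ n → ∑ k ∈ Icc 1 n, primeLogDiv k ≤ Real.log n + Ehi)
    (hlo : ∀ n : ℕ, 1 ≤ n → Real.log n - Elo ≤ ∑ k ∈ Icc 1 n, primeLogDiv k) :
    Real.log n - Real.log m - (Elo + Ehi) ≤ ∑ k ∈ Icc (m + 1) n, primeLogDiv k := by
  have hsplit : ∑ k ∈ Icc 1 n, primeLogDiv k = ∑ k ∈ Icc 1 m, primeLogDiv k + ∑ k ∈ Icc (m + 1) n, primeLogDiv k := by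
    have hU : Icc 1 n = Icc 1 m ∪ Icc (m + 1) n := by
      ext k; simp only [Finset.mem_union, Finset.mem_Icc]; omega
    rw [hU, Finset.sum_union]
    rw [Finset.disjoint_left]; intro k hk hk'
    have := Finset.mem_Icc.1 hk; have := Finset.mem_Icc.1 hk'; omega
  have h1 := hlo n (by omega)
  have h2 := hhi m hm
  linarith

/-- The Mertens constants are jointly non-negative: `0 ≤ E_lo + E_hi` (take `n = 1`). -/
theorem mertens_consts_nonneg {Elo Ehi : ℝ}
    (hhi : ∀ n : ℕ, 1 ≤ n → ∑ k ∈ Icc 1 n, primeLogDiv k ≤ Real.log n + Ehi)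
    (hlo : ∀ n : ℕ, 1 ≤ n → Real.log n - Elo ≤ ∑ k ∈ Icc 1 n, primeLogDiv k) : 0 ≤ Elo + Ehi := by
  have h1 := hhi 1 le_rfl
  have h2 := hlo 1 le_rfl
  linarith

/-! ### The upper bound -/

/-- **`τ(b)` from above (CONTINUUM-LIMIT 25.10 (b)).**  `3 ≤ p`, `R < p²`, `A ≥ 1` with the pointwise Green
bound `Γ(x) ≤ A log R/log x` on `(R/p, R]` (`exitGamma_le` or `exitGamma_le_sharp'`), two-sided Mertens bounds
for the primes with constants `E_lo, E_hi`,
`1 ≤ b`, `p ≤ R/b` ⊢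
`τ(b) ≤ A·log R·[(E_lo+E_hi)/(log b + log(p−1))² + (1/(log b + log(p−1)) − 1/(log b + log⌊R/b⌋))]`. -/
theorem exitTilt_le {R p : ℕ} (hp : 3 ≤ p) (hR : R < p ^ 2) {A : ℝ} (hA1 : 1 ≤ A)
    (hΓU : ∀ x, R / p < x → x ≤ R → exitGamma R (R / p) x ≤ A * Real.log R / Real.log x) {Elo Ehi : ℝ}
    (hhi : ∀ n : ℕ, 1 ≤ n → ∑ k ∈ Icc 1 n, primeLogDiv k ≤ Real.log n + Ehi)
    (hlo : ∀ n : ℕ, 1 ≤ n → Real.log n - Elo ≤ ∑ k ∈ Icc 1 n, primeLogDiv k)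
    {b : ℕ} (hb : 1 ≤ b) (hbR : p ≤ R / b) :
    exitTilt R p b ≤ A * Real.log R * ((Elo + Ehi) * (1 / (Real.log b + Real.log ((p - 1 : ℕ) : ℝ)) ^ 2) +
      (1 / (Real.log b + Real.log ((p - 1 : ℕ) : ℝ)) - 1 / (Real.log b + Real.log ((R / b : ℕ) : ℝ)))) := by
  have hpp : R / p < p := (Nat.div_lt_iff_lt_mul (by omega)).2 (by nlinarith)
  have hL : 0 ≤ Real.log R := Real.log_natCast_nonneg R
  have hAL : 0 ≤ A * Real.log R := mul_nonneg (by linarith) hL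
  rw [exitTilt_eq_sum_primes (by omega) hR hb]
  -- Γ(bq) ≤ A L / log(bq)
  have hΓ : ∀ q ∈ (Icc p (R / b)).filter Nat.Prime,
      exitGamma R (R / p) (b * q) * (Real.log q / ((q : ℝ) * Real.log ((b * q : ℕ) : ℝ))) ≤
        A * Real.log R * ((1 / (Real.log b + Real.log q) ^ 2) * (Real.log q / q)) := by
    intro q hq
    have hq' := Finset.mem_filter.1 hq
    have hI := Finset.mem_Icc.1 hq'.1
    have hq2 : 2 ≤ q := hq'.2.two_le
    have hbq1 : R / p < b * q := lt_of_lt_of_le hpp (le_trans hI.1 (Nat.le_mul_of_pos_left q (by omega)))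
    have hbq2 : b * q ≤ R := by
      have := (Nat.le_div_iff_mul_le (by omega)).1 hI.2
      rwa [mul_comm] at this
    have hG := hΓU (b * q) hbq1 hbq2
    have hlogbq : Real.log ((b * q : ℕ) : ℝ) = Real.log b + Real.log q := by
      push_cast
      exact Real.log_mul (by exact_mod_cast (show b ≠ 0 by omega)) (by exact_mod_cast (show q ≠ 0 by omega))
    have hlogq : 0 < Real.log q := Real.log_pos (by exact_mod_cast (show 1 < q by omega))
    have hlogb : 0 ≤ Real.log b := Real.log_natCast_nonneg b
    have hpos : 0 < Real.log b + Real.log q := by linarith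
    have hw : 0 ≤ Real.log q / ((q : ℝ) * Real.log ((b * q : ℕ) : ℝ)) := by
      rw [hlogbq]; positivity
    calc exitGamma R (R / p) (b * q) * (Real.log q / ((q : ℝ) * Real.log ((b * q : ℕ) : ℝ)))
        ≤ A * Real.log R / Real.log ((b * q : ℕ) : ℝ) * (Real.log q / ((q : ℝ) * Real.log ((b * q : ℕ) : ℝ))) :=
          mul_le_mul_of_nonneg_right hG hw
      _ = A * Real.log R * ((1 / (Real.log b + Real.log q) ^ 2) * (Real.log q / q)) := by
          rw [hlogbq]
          have hq0 : (q : ℝ) ≠ 0 := by positivity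
          field_simp
  refine (Finset.sum_le_sum hΓ).trans ?_
  rw [← Finset.mul_sum, sum_filter_prime_eq_sum_primeLogDiv]
  refine mul_le_mul_of_nonneg_left ?_ hAL
  -- range Abel with m = p − 1, N = R/b, s = log b, c = Elo + Ehi
  have hm : 1 ≤ p - 1 := by omega
  have hp1 : p - 1 + 1 = p := by omega
  have hc : 0 ≤ Elo + Ehi := mertens_consts_nonneg hhi hlo
  have hA' : ∀ n, p - 1 + 1 ≤ n → n ≤ R / b →
      ∑ k ∈ Icc (p - 1 + 1) n, primeLogDiv k ≤ Real.log n - Real.log ((p - 1 : ℕ) : ℝ) + (Elo + Ehi) :=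
    fun n hn _ => sum_Icc_primeLogDiv_le hm hn hhi hlo
  have hs : 0 < Real.log b + Real.log ((p - 1 : ℕ) : ℝ) := by
    have h2 : (2 : ℝ) ≤ ((p - 1 : ℕ) : ℝ) := by exact_mod_cast (show 2 ≤ p - 1 by omega)
    have := Real.log_pos (show (1 : ℝ) < ((p - 1 : ℕ) : ℝ) by linarith)
    linarith [Real.log_natCast_nonneg b]
  have key := sum_Icc_mul_inv_sq_le' hm (by omega : p - 1 ≤ R / b) hc hA' hs
  rw [hp1] at key
  exact key

/-! ### The lower bound -/

/-- **`τ(b)` from below (CONTINUUM-LIMIT 25.10 (b)).**  `3 ≤ p`, `R < p²`, `B ≥ 0` with the pointwise Green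
bound `B log R/log x ≤ Γ(x)` on `(R/p, R]` (`le_exitGamma` or `le_exitGamma_sharp'`), two-sided Mertens bounds
for the primes, `1 ≤ b`, `p ≤ R/b` ⊢
`B·log R·[1/(log b + log p) − 1/(log b + log(⌊R/b⌋+1)) − (E_lo+E_hi)/(log b + log(p−1))²] ≤ τ(b)`. -/
theorem le_exitTilt {R p : ℕ} (hp : 3 ≤ p) (hR : R < p ^ 2) {B : ℝ} (hB0 : 0 ≤ B)
    (hΓL : ∀ x, R / p < x → x ≤ R → B * Real.log R / Real.log x ≤ exitGamma R (R / p) x)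
    {Elo Ehi : ℝ}
    (hhi : ∀ n : ℕ, 1 ≤ n → ∑ k ∈ Icc 1 n, primeLogDiv k ≤ Real.log n + Ehi)
    (hlo : ∀ n : ℕ, 1 ≤ n → Real.log n - Elo ≤ ∑ k ∈ Icc 1 n, primeLogDiv k)
    {b : ℕ} (hb : 1 ≤ b) (hbR : p ≤ R / b) :
    B * Real.log R * (1 / (Real.log b + Real.log p) - 1 / (Real.log b + Real.log ((R / b + 1 : ℕ) : ℝ)) -
        (Elo + Ehi) * (1 / (Real.log b + Real.log ((p - 1 : ℕ) : ℝ)) ^ 2)) ≤ exitTilt R p b := by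
  have hpp : R / p < p := (Nat.div_lt_iff_lt_mul (by omega)).2 (by nlinarith)
  have hL : 0 ≤ Real.log R := Real.log_natCast_nonneg R
  have hBL : 0 ≤ B * Real.log R := mul_nonneg hB0 hL
  rw [exitTilt_eq_sum_primes (by omega) hR hb]
  have hΓ : ∀ q ∈ (Icc p (R / b)).filter Nat.Prime,
      B * Real.log R * ((1 / (Real.log b + Real.log q) ^ 2) * (Real.log q / q)) ≤
        exitGamma R (R / p) (b * q) * (Real.log q / ((q : ℝ) * Real.log ((b * q : ℕ) : ℝ))) := by
    intro q hq
    have hq' := Finset.mem_filter.1 hq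
    have hI := Finset.mem_Icc.1 hq'.1
    have hq2 : 2 ≤ q := hq'.2.two_le
    have hbq1 : R / p < b * q := lt_of_lt_of_le hpp (le_trans hI.1 (Nat.le_mul_of_pos_left q (by omega)))
    have hbq2 : b * q ≤ R := by
      have := (Nat.le_div_iff_mul_le (by omega)).1 hI.2
      rwa [mul_comm] at this
    have hG := hΓL (b * q) hbq1 hbq2
    have hlogbq : Real.log ((b * q : ℕ) : ℝ) = Real.log b + Real.log q := by
      push_cast
      exact Real.log_mul (by exact_mod_cast (show b ≠ 0 by omega)) (by exact_mod_cast (show q ≠ 0 by omega))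
    have hlogq : 0 < Real.log q := Real.log_pos (by exact_mod_cast (show 1 < q by omega))
    have hlogb : 0 ≤ Real.log b := Real.log_natCast_nonneg b
    have hpos : 0 < Real.log b + Real.log q := by linarith
    have hw : 0 ≤ Real.log q / ((q : ℝ) * Real.log ((b * q : ℕ) : ℝ)) := by
      rw [hlogbq]; positivity
    calc B * Real.log R * ((1 / (Real.log b + Real.log q) ^ 2) * (Real.log q / q))
        = B * Real.log R / Real.log ((b * q : ℕ) : ℝ) * (Real.log q / ((q : ℝ) * Real.log ((b * q : ℕ) : ℝ))) := by
          rw [hlogbq]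
          have hq0 : (q : ℝ) ≠ 0 := by positivity
          field_simp
      _ ≤ exitGamma R (R / p) (b * q) * (Real.log q / ((q : ℝ) * Real.log ((b * q : ℕ) : ℝ))) :=
          mul_le_mul_of_nonneg_right hG hw
  refine le_trans ?_ (Finset.sum_le_sum hΓ)
  rw [← Finset.mul_sum, sum_filter_prime_eq_sum_primeLogDiv]
  refine mul_le_mul_of_nonneg_left ?_ hBL
  have hm : 1 ≤ p - 1 := by omega
  have hp1 : p - 1 + 1 = p := by omega
  have hc : 0 ≤ Elo + Ehi := mertens_consts_nonneg hhi hlo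
  have hA' : ∀ n, p - 1 + 1 ≤ n → n ≤ R / b →
      Real.log n - Real.log ((p - 1 : ℕ) : ℝ) - (Elo + Ehi) ≤ ∑ k ∈ Icc (p - 1 + 1) n, primeLogDiv k :=
    fun n hn _ => le_sum_Icc_primeLogDiv hm hn hhi hlo
  have hs : 0 < Real.log b + Real.log ((p - 1 : ℕ) : ℝ) := by
    have h2 : (2 : ℝ) ≤ ((p - 1 : ℕ) : ℝ) := by exact_mod_cast (show 2 ≤ p - 1 by omega)
    have := Real.log_pos (show (1 : ℝ) < ((p - 1 : ℕ) : ℝ) by linarith)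
    linarith [Real.log_natCast_nonneg b]
  have key := sum_Icc_mul_inv_sq_ge' hm (by omega : p - 1 ≤ R / b) hc hA' hs
  rw [hp1] at key
  exact key

end Summit.RiemannHypothesis.RiemannHypothesis.Theorems.IntegerScrew

end
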